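/-
Copyright (c) 2026. All rights reserved.
Released under Apache 2.0 license as described in the file LICENSE.
-/
import Literature.MathematicalPhysics.QuantumLattice.HartreeFockBlochTorus
import Literature.LinearAlgebra.Matrix.NearIdempotentShrink
import Literature.MathematicalPhysics.QuantumLattice.HartreeFockBlochMixture
import HarnessLib

/-!
# Translation-invariant quasi-free (Hartree–Fock class) certificates: the Bloch blocks of a finitely
# supported one-body kernel, their exact cell energy, and their admissibility from a defect bound

Topic `MathematicalPhysics/QuantumLattice`, family `hubbard`; continuation of
`HartreeFockBlochTorus.lean` (cell-momentum blocks `Q σ κ`, `blochEnergy`) towards the soundness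
theorem of CERTIFIED quasi-free upper bounds on the Hubbard energy density. A certificate is a
superlattice-periodic one-body kernel: a cell `Π_i ℤ/(M i)ℤ`, a finite symmetric set `S ⊂ ℤ^d` of
superlattice vectors and matrices `γ_σ(R)` (`R ∈ S`, zero outside) with `γ_σ(-R) = γ_σ(R)ᴴ`.
For a torus of `Π_i k i` cells its Bloch blocks are the discrete Fourier modes

  `kernelBlock S γ κ = Σ_{R ∈ S} χ_κ(R̄) • γ R`     (`R̄` = `R` mod `k`, `χ_κ` = `blockChar`).

Results (all `d`; no aliasing = every `R - v`, `R ∈ S`, `v ∈ {0, ±eᵢ}`, that vanishes mod `k`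
vanishes — true as soon as `k i ≥ Rc i + 2`):

* `kernelBlock_conjTranspose` — the blocks are Hermitian;
* `sum_trace_kernelBlock` — `Σ_κ tr Q_κ = |k| · tr γ(0)`;
* `blochDensity_kernelBlock` — the cell density is `γ_σ(0)(p,p)`;
* **`blochEnergy_kernelBlock`** — `blochEnergy t U Q = |k| · qfCellEnergy t U γ`, the EXACT finite
  cell expression `qfCellEnergy` (nearest-neighbour bonds inside the cell read `γ(0)`, bonds leaving
  through the face `i` read `γ(∓eᵢ)`; interaction `U Σ_p γ↑(0)(p,p) γ↓(0)(p,p)`) — the number a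
  certificate states as an exact rational;
* **`kernelBlock_sub_sq`** — `Q̃_κ - Q̃_κ² = Σ_{T ∈ S ∪ (S+S)} χ_κ(T̄) • d(T)` with the DEFECT KERNEL
  `d(T) = γ̃(T)·[T ∈ S] - Σ_{R+R'=T} γ̃(R) γ̃(R')` (integer data in a certificate), whence, by
  `Literature.LinearAlgebra.Matrix.posSemidef_affine_shrink_of_sum`, the affine image
  `a • Q̃_κ + b • 1` is an admissible block (`0 ⪯ · ⪯ 1`) under the certificate's three rational
  inequalities and Frobenius bounds `‖d(T)‖_F ≤ c_T` (`kernelBlock_affine_posSemidef`);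
* `kernelBlock_affine` — `a • Q̃_κ + b • 1` is the block of the shrunk kernel `a γ̃ + b δ_{R,0} 1`.

With the Bloch-form Lieb bound for admissible blocks (`HartreeFockBlochMixture.lean`) and
`L → ∞` these give `e(t,U;n) ≤ re qfCellEnergy / |cell|` — assembled in a sequel. Everything here is
proved; the definitions have bodies; no named facts.

## Mathlib / tree search

Tree (REUSED): `blockChar`, `blockChar_add_right`, `blockChar_neg_right`, `blockChar_mul_conj`,
`sum_blockChar_left`, `facePhase`, `blochDensity`, `blochEnergy`, `card_cells_ne_zero`
(`HartreeFockBlochTorus`); `posSemidef_affine_shrink_of_sum` (`NearIdempotentShrink`). Mathlib: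
`Finset.sum_fiberwise_of_maps_to`, `Finset.sum_ite_eq'`, `ZMod.intCast_cast`, `Complex.mul_conj`.

## References

* V. Bach, E. H. Lieb, J. P. Solovej, *Generalized Hartree–Fock theory and the Hubbard model*,
  J. Stat. Phys. 76 (1994) 3, eqs. (2c.4), (2c.8), (3a.2). [BachLiebSolovej1994]
* J. Xu, C.-C. Chang, E. J. Walter, S. Zhang, J. Phys.: Condens. Matter 23 (2011) 505601, §2
  (supercell Bloch reduction). [folklore]
-/

noncomputable section

namespace Literature.MathematicalPhysics.QuantumLattice

namespace HartreeFock

open Matrix Finset Literature.Probability.LatticeModels HeisenbergTL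
open scoped ComplexConjugate ComplexOrder

section Kernel

variable {d : ℕ} {k M : Fin d → ℕ} [∀ i, NeZero (k i)] [∀ i, NeZero (M i)]

/-- Reduction of an integer superlattice vector modulo the cell counts `k`. [folklore] -/
def cellVec (k : Fin d → ℕ) (R : Fin d → ℤ) : RectTorusSite k := fun i => ((R i : ℤ) : ZMod (k i))

omit [∀ i, NeZero (k i)] in
/-- `cellVec` is additive. [folklore] -/
@[simp] private theorem cellVec_add (R T : Fin d → ℤ) : cellVec k (R + T) = cellVec k R + cellVec k T := by
  funext i; simp [cellVec]

omit [∀ i, NeZero (k i)] in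
/-- `cellVec` is odd. [folklore] -/
@[simp] private theorem cellVec_neg (R : Fin d → ℤ) : cellVec k (-R) = -cellVec k R := by
  funext i; simp [cellVec]

omit [∀ i, NeZero (k i)] in
/-- `cellVec` of a difference. [folklore] -/
@[simp] private theorem cellVec_sub (R T : Fin d → ℤ) : cellVec k (R - T) = cellVec k R - cellVec k T := by
  funext i; simp [cellVec]

omit [∀ i, NeZero (k i)] in
/-- `cellVec 0 = 0`. [folklore] -/
@[simp] private theorem cellVec_zero : cellVec k (0 : Fin d → ℤ) = 0 := by
  funext i; simp [cellVec]

omit [∀ i, NeZero (k i)] in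
/-- `cellVec eᵢ = eᵢ`. [folklore] -/
@[simp] private theorem cellVec_single (i : Fin d) : cellVec k (Pi.single i (1 : ℤ)) = Pi.single i 1 := by
  funext j
  by_cases h : j = i
  · subst h; simp [cellVec]
  · simp [cellVec, Pi.single_eq_of_ne h]

/-- `|χ_κ(X)| = 1`. [folklore] -/
private theorem norm_blockChar (κ X : RectTorusSite k) : ‖blockChar κ X‖ = 1 := by
  have h := blockChar_mul_conj κ X
  have h2 : Complex.normSq (blockChar κ X) = 1 := by
    rw [← Complex.ofReal_inj, Complex.ofReal_one, ← h, Complex.mul_conj]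
  rw [← Complex.sq_norm] at h2  -- fallback below if the name differs
  nlinarith [norm_nonneg (blockChar κ X)]

/-- **The Bloch blocks of a finitely supported kernel**: `Q_κ = Σ_{R ∈ S} χ_κ(R̄) • γ(R)`.
[cite: BachLiebSolovej1994, eq. (3a.2)] -/
def kernelBlock (S : Finset (Fin d → ℤ)) (γ : (Fin d → ℤ) → Matrix (RectTorusSite M) (RectTorusSite M) ℂ)
    (κ : RectTorusSite k) : Matrix (RectTorusSite M) (RectTorusSite M) ℂ :=
  ∑ R ∈ S, blockChar κ (cellVec k R) • γ R

/-- **No aliasing** of the kernel support against the cell counts: a superlattice vector `R - v`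
(`R ∈ S`, `v` with coordinates in `{0, ±1}`) that vanishes modulo `k` vanishes — the supercell
Bloch reduction reads every bond of the cell from a unique kernel entry. [cite: BachLiebSolovej1994, eq. (3a.2)] -/
def NoAlias (k : Fin d → ℕ) (S : Finset (Fin d → ℤ)) : Prop :=
  ∀ R ∈ S, ∀ v : Fin d → ℤ, (∀ j, v j = 0 ∨ v j = 1 ∨ v j = -1) → cellVec k (R - v) = 0 → R = v

/-- **Character orthogonality against the kernel**: for `f` vanishing outside `S` and `v` with
coordinates in `{0, ±1}`, `Σ_{R ∈ S} f(R) Σ_κ χ_κ(R̄ - v̄) = |k| f(v)`. [folklore] -/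
private theorem sum_mul_sum_blockChar_cellVec_sub {S : Finset (Fin d → ℤ)} (hS : NoAlias k S) {f : (Fin d → ℤ) → ℂ}
    (hf : ∀ R ∉ S, f R = 0) {v : Fin d → ℤ} (hv : ∀ j, v j = 0 ∨ v j = 1 ∨ v j = -1) :
    ∑ R ∈ S, f R * ∑ κ : RectTorusSite k, blockChar κ (cellVec k (R - v)) =
      (Fintype.card (RectTorusSite k) : ℂ) * f v := by
  have hterm : ∀ R ∈ S, f R * ∑ κ : RectTorusSite k, blockChar κ (cellVec k (R - v)) =
      if R = v then (Fintype.card (RectTorusSite k) : ℂ) * f R else 0 := by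
    intro R hR
    rw [sum_blockChar_left]
    by_cases h : R = v
    · subst h; rw [sub_self, cellVec_zero, if_pos rfl, if_pos rfl, mul_comm]
    · rw [if_neg (fun h0 => h (hS R hR v hv h0)), if_neg h, mul_zero]
  rw [Finset.sum_congr rfl hterm, Finset.sum_ite_eq']
  split_ifs with h
  · rfl
  · rw [hf v h, mul_zero]

variable (S : Finset (Fin d → ℤ)) (γ : (Fin d → ℤ) → Matrix (RectTorusSite M) (RectTorusSite M) ℂ)

omit [∀ i, NeZero (M i)] in
/-- Entries of a block. [folklore] -/
private theorem kernelBlock_apply (κ : RectTorusSite k) (p q : RectTorusSite M) :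
    kernelBlock S γ κ p q = ∑ R ∈ S, blockChar κ (cellVec k R) * γ R p q := by
  simp [kernelBlock, Matrix.sum_apply]

omit [∀ i, NeZero (M i)] in
/-- **The blocks of a symmetric kernel are Hermitian**: if `S = -S` and `γ(-R) = γ(R)ᴴ` then
`(Q_κ)ᴴ = Q_κ`. [cite: BachLiebSolovej1994, eq. (3a.2)] -/
theorem isHermitian_kernelBlock (hSneg : ∀ R ∈ S, -R ∈ S) (hγ : ∀ R, γ (-R) = (γ R)ᴴ)
    (κ : RectTorusSite k) : (kernelBlock S γ κ).IsHermitian := by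
  unfold kernelBlock
  rw [Matrix.IsHermitian, Matrix.conjTranspose_sum]
  simp_rw [Matrix.conjTranspose_smul]
  -- reindex `R ↦ -R`
  have hbij : ∑ R ∈ S, star (blockChar κ (cellVec k R)) • (γ R)ᴴ =
      ∑ R ∈ S, star (blockChar κ (cellVec k (-R))) • (γ (-R))ᴴ := by
    refine Finset.sum_nbij' (fun R => -R) (fun R => -R) (fun R hR => hSneg R hR)
      (fun R hR => hSneg R hR) (fun R _ => neg_neg R) (fun R _ => neg_neg R) (fun R _ => ?_)
    rw [neg_neg]
  rw [hbij]
  refine Finset.sum_congr rfl fun R _ => ?_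
  rw [← hγ (-R), neg_neg, cellVec_neg, blockChar_neg_right, Complex.star_def, Complex.conj_conj]

/-- **`Σ_κ tr Q_κ = |k| · tr γ(0)`** (no aliasing; `γ` vanishing outside `S`).
[cite: BachLiebSolovej1994, eq. (3a.2)] -/
theorem sum_trace_kernelBlock (hS : NoAlias k S) (hγS : ∀ R ∉ S, γ R = 0) :
    ∑ κ : RectTorusSite k, (kernelBlock S γ κ).trace =
      (Fintype.card (RectTorusSite k) : ℂ) * (γ 0).trace := by
  unfold kernelBlock
  simp_rw [Matrix.trace_sum, Matrix.trace_smul, smul_eq_mul]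
  rw [Finset.sum_comm]
  simp_rw [← Finset.sum_mul]
  have h := sum_mul_sum_blockChar_cellVec_sub (k := k) hS (f := fun R => (γ R).trace)
    (fun R hR => by rw [hγS R hR, Matrix.trace_zero]) (v := 0) (fun j => Or.inl rfl)
  simp only [sub_zero] at h
  rw [← h]
  refine Finset.sum_congr rfl fun R _ => ?_
  rw [mul_comm]

omit [∀ i, NeZero (M i)] in
/-- **The cell density of the kernel blocks is `γ_σ(0)(p,p)`.** [cite: BachLiebSolovej1994, eq. (3a.2)] -/
theorem blochDensity_kernelBlock (hS : NoAlias k S) (hγS : ∀ R ∉ S, γ R = 0) (p : RectTorusSite M) :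
    blochDensity (k := k) (kernelBlock (k := k) S γ) p = γ 0 p p := by
  unfold blochDensity
  simp_rw [kernelBlock_apply]
  rw [Finset.sum_comm]
  simp_rw [← Finset.sum_mul]
  have h := sum_mul_sum_blockChar_cellVec_sub (k := k) hS (f := fun R => γ R p p)
    (fun R hR => by rw [hγS R hR]; rfl) (v := 0) (fun j => Or.inl rfl)
  simp only [sub_zero] at h
  have h' : ∑ R ∈ S, (∑ κ : RectTorusSite k, blockChar κ (cellVec k R)) * γ R p p =
      (Fintype.card (RectTorusSite k) : ℂ) * γ 0 p p := by
    rw [← h]; exact Finset.sum_congr rfl fun R _ => mul_comm _ _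
  rw [h', ← mul_assoc, inv_mul_cancel₀ card_cells_ne_zero, one_mul]

/-- The superlattice vector read by the bond `p → p + eᵢ`: `0` inside the cell, `-eᵢ` across the
face `pᵢ = Mᵢ - 1` (for the entry `(p+eᵢ, p)`; the entry `(p, p+eᵢ)` reads its negative).
[folklore] -/
def faceShift (M : Fin d → ℕ) (i : Fin d) (p : RectTorusSite M) : Fin d → ℤ :=
  if (p i).val + 1 < M i then 0 else -Pi.single i 1

omit [∀ i, NeZero (M i)] in
/-- The coordinates of `faceShift` lie in `{0, ±1}`. [folklore] -/
private theorem faceShift_coord (i : Fin d) (p : RectTorusSite M) (j : Fin d) :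
    faceShift M i p j = 0 ∨ faceShift M i p j = 1 ∨ faceShift M i p j = -1 := by
  unfold faceShift
  split_ifs
  · exact Or.inl rfl
  · by_cases h : j = i
    · subst h; simp
    · simp [Pi.single_eq_of_ne h]

omit [∀ i, NeZero (M i)] in
/-- The coordinates of `-faceShift` lie in `{0, ±1}`. [folklore] -/
private theorem neg_faceShift_coord (i : Fin d) (p : RectTorusSite M) (j : Fin d) :
    (-faceShift M i p) j = 0 ∨ (-faceShift M i p) j = 1 ∨ (-faceShift M i p) j = -1 := by
  rcases faceShift_coord (M := M) i p j with h | h | h <;> simp [Pi.neg_apply, h]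

omit [∀ i, NeZero (M i)] in
/-- `θ_κ,i(p) · χ_κ(R̄) = χ_κ(R̄ - faceShift̄)`. [folklore] -/
private theorem facePhase_mul_blockChar (κ : RectTorusSite k) (i : Fin d) (p : RectTorusSite M) (R : Fin d → ℤ) :
    facePhase κ i p * blockChar κ (cellVec k R) = blockChar κ (cellVec k (R - faceShift M i p)) := by
  unfold facePhase faceShift
  split_ifs
  · simp
  · rw [sub_neg_eq_add, cellVec_add, cellVec_single, blockChar_add_right, mul_comm]

omit [∀ i, NeZero (M i)] in
/-- `conj θ_κ,i(p) · χ_κ(R̄) = χ_κ(R̄ + faceShift̄)`. [folklore] -/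
private theorem conj_facePhase_mul_blockChar (κ : RectTorusSite k) (i : Fin d) (p : RectTorusSite M)
    (R : Fin d → ℤ) :
    conj (facePhase κ i p) * blockChar κ (cellVec k R) =
      blockChar κ (cellVec k (R - -faceShift M i p)) := by
  unfold facePhase faceShift
  split_ifs
  · simp
  · rw [neg_neg, sub_eq_add_neg, cellVec_add, cellVec_neg, cellVec_single, blockChar_add_right,
      blockChar_neg_right, mul_comm]

/-- **The exact cell energy of a quasi-free certificate** (the number the certificate states):
`-t Σ_σ Σ_i Σ_p [γ_σ(faceShift i p)(p+eᵢ, p) + γ_σ(-faceShift i p)(p, p+eᵢ)]`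
`  + U Σ_p γ↑(0)(p,p) γ↓(0)(p,p)`. [cite: BachLiebSolovej1994, eq. (2c.8)] -/
def qfCellEnergy (t U : ℝ) (γ : Fin 2 → (Fin d → ℤ) → Matrix (RectTorusSite M) (RectTorusSite M) ℂ) : ℂ :=
  -(t : ℂ) * (∑ σ, ∑ i : Fin d, ∑ p : RectTorusSite M,
      (γ σ (faceShift M i p) (p + Pi.single i 1) p + γ σ (-faceShift M i p) p (p + Pi.single i 1))) +
    (U : ℂ) * ∑ p : RectTorusSite M, γ 0 0 p p * γ 1 0 p p

/-- **The Bloch energy of the kernel blocks is `|k|` times the exact cell energy.**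
[cite: BachLiebSolovej1994, eq. (2c.8)] -/
theorem blochEnergy_kernelBlock (hS : NoAlias k S)
    (γ : Fin 2 → (Fin d → ℤ) → Matrix (RectTorusSite M) (RectTorusSite M) ℂ)
    (hγS : ∀ σ, ∀ R ∉ S, γ σ R = 0) (t U : ℝ) :
    blochEnergy t U (fun σ => kernelBlock (k := k) S (γ σ)) =
      (Fintype.card (RectTorusSite k) : ℂ) * qfCellEnergy t U γ := by
  set c : ℂ := (Fintype.card (RectTorusSite k) : ℂ) with hc
  rw [blochEnergy, qfCellEnergy]
  have hkin : ∀ (σ : Fin 2) (i : Fin d) (p : RectTorusSite M),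
      ∑ κ : RectTorusSite k, (facePhase κ i p * kernelBlock S (γ σ) κ (p + Pi.single i 1) p +
        conj (facePhase κ i p) * kernelBlock S (γ σ) κ p (p + Pi.single i 1)) =
      c * (γ σ (faceShift M i p) (p + Pi.single i 1) p + γ σ (-faceShift M i p) p (p + Pi.single i 1)) := by
    intro σ i p
    simp_rw [kernelBlock_apply, Finset.mul_sum, ← mul_assoc, facePhase_mul_blockChar,
      conj_facePhase_mul_blockChar]
    rw [Finset.sum_add_distrib, Finset.sum_comm, Finset.sum_comm (f := fun κ R => _ * γ σ R p _)]
    simp_rw [← Finset.sum_mul]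
    have h1 := sum_mul_sum_blockChar_cellVec_sub (k := k) hS (f := fun R => γ σ R (p + Pi.single i 1) p)
      (fun R hR => by rw [hγS σ R hR]; rfl) (faceShift_coord (M := M) i p)
    have h2 := sum_mul_sum_blockChar_cellVec_sub (k := k) hS (f := fun R => γ σ R p (p + Pi.single i 1))
      (fun R hR => by rw [hγS σ R hR]; rfl) (neg_faceShift_coord (M := M) i p)
    rw [← hc] at h1 h2
    rw [mul_add, ← h1, ← h2]
    congr 1 <;> exact Finset.sum_congr rfl fun R _ => mul_comm _ _
  have hK : ∑ σ : Fin 2, ∑ κ : RectTorusSite k, ∑ i : Fin d, ∑ p : RectTorusSite M,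
      (facePhase κ i p * kernelBlock S (γ σ) κ (p + Pi.single i 1) p +
        conj (facePhase κ i p) * kernelBlock S (γ σ) κ p (p + Pi.single i 1)) =
      c * ∑ σ : Fin 2, ∑ i : Fin d, ∑ p : RectTorusSite M,
        (γ σ (faceShift M i p) (p + Pi.single i 1) p + γ σ (-faceShift M i p) p (p + Pi.single i 1)) := by
    rw [Finset.mul_sum]
    refine Finset.sum_congr rfl fun σ _ => ?_
    rw [Finset.sum_comm, Finset.mul_sum]
    refine Finset.sum_congr rfl fun i _ => ?_
    rw [Finset.sum_comm, Finset.mul_sum]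
    refine Finset.sum_congr rfl fun p _ => ?_
    exact hkin σ i p
  rw [hK]
  simp_rw [blochDensity_kernelBlock (k := k) S (γ _) hS (hγS _)]
  rw [← hc]
  ring

/-! ### The defect of idempotency and the admissibility of the shrunk blocks -/

/-- The support of the defect kernel: `S ∪ (S + S)`. [folklore] -/
def defectSupport (S : Finset (Fin d → ℤ)) : Finset (Fin d → ℤ) :=
  S ∪ (S ×ˢ S).image (fun x => x.1 + x.2)

/-- **The defect kernel** `d(T) = γ̃(T)·[T ∈ S] - Σ_{R + R' = T} γ̃(R) γ̃(R')` — the superlattice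
Fourier coefficients of `G̃ - G̃²` (integer data in a certificate, up to the dyadic scale).
[cite: BachLiebSolovej1994, eq. (2c.4)] -/
def defectKernel (T : Fin d → ℤ) : Matrix (RectTorusSite M) (RectTorusSite M) ℂ :=
  (if T ∈ S then γ T else 0) - ∑ x ∈ (S ×ˢ S).filter (fun x => x.1 + x.2 = T), γ x.1 * γ x.2

/-- **`Q̃_κ - Q̃_κ² = Σ_{T ∈ S ∪ (S+S)} χ_κ(T̄) • d(T)`** — the block defect is the Fourier mode of
the defect kernel (characters are multiplicative; no aliasing hypothesis is needed).
[cite: BachLiebSolovej1994, eq. (2c.4)] -/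
theorem kernelBlock_sub_sq (κ : RectTorusSite k) :
    kernelBlock S γ κ - kernelBlock S γ κ * kernelBlock S γ κ =
      ∑ T ∈ defectSupport S, blockChar κ (cellVec k T) • defectKernel S γ T := by
  have hQ : kernelBlock (k := k) S γ κ =
      ∑ T ∈ defectSupport S, blockChar κ (cellVec k T) • (if T ∈ S then γ T else 0) := by
    unfold kernelBlock defectSupport
    rw [← Finset.sum_subset (Finset.subset_union_left (s₂ := (S ×ˢ S).image (fun x => x.1 + x.2)))
      (fun T _ hTS => by rw [if_neg hTS, smul_zero])]
    exact Finset.sum_congr rfl fun T hT => by rw [if_pos hT]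
  have hmaps : ∀ x ∈ S ×ˢ S, x.1 + x.2 ∈ defectSupport S := fun x hx =>
    Finset.mem_union_right _ (Finset.mem_image_of_mem _ hx)
  have hQQ : kernelBlock (k := k) S γ κ * kernelBlock S γ κ =
      ∑ T ∈ defectSupport S, blockChar κ (cellVec k T) •
        ∑ x ∈ (S ×ˢ S).filter (fun x => x.1 + x.2 = T), γ x.1 * γ x.2 := by
    unfold kernelBlock
    rw [Finset.sum_mul]
    simp_rw [Finset.mul_sum, Matrix.smul_mul, Matrix.mul_smul, smul_smul]
    rw [← Finset.sum_product' (f := fun R R' => (blockChar κ (cellVec k R) * blockChar κ (cellVec k R')) • (γ R * γ R')),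
      ← Finset.sum_fiberwise_of_maps_to hmaps]
    refine Finset.sum_congr rfl fun T _ => ?_
    rw [Finset.smul_sum]
    refine Finset.sum_congr rfl fun x hx => ?_
    rw [(Finset.mem_filter.1 hx).2.symm, cellVec_add, blockChar_add_right]
  rw [hQQ, hQ, ← Finset.sum_sub_distrib]
  refine Finset.sum_congr rfl fun T _ => ?_
  rw [defectKernel, smul_sub]

/-- The Frobenius norm of a character multiple: `Σ ‖(χ • X) i j‖² = Σ ‖X i j‖²`. [folklore] -/
private theorem frobenius_blockChar_smul (κ X : RectTorusSite k) (A : Matrix (RectTorusSite M) (RectTorusSite M) ℂ) :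
    ∑ i, ∑ j, ‖(blockChar κ X • A) i j‖ ^ 2 = ∑ i, ∑ j, ‖A i j‖ ^ 2 := by
  refine Finset.sum_congr rfl fun i _ => Finset.sum_congr rfl fun j _ => ?_
  rw [Matrix.smul_apply, smul_eq_mul, norm_mul, norm_blockChar, one_mul]

/-- **Admissibility of the shrunk blocks from the defect bound.** If `S = -S`, `γ̃(-R) = γ̃(R)ᴴ`,
the defect kernel obeys the Frobenius bounds `‖d(T)‖_F ≤ c_T` on `S ∪ (S+S)`, and the reals
`a ≥ 0`, `b` satisfy `a · Σ_T c_T ≤ b`, `a (1 + Σ_T c_T) + b ≤ 1`, then for EVERY cell count `k` and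
every momentum `κ` the block `a • Q̃_κ + b • 1` satisfies `0 ⪯ · ⪯ 1`.
[cite: BachLiebSolovej1994, eq. (2c.4)] -/
theorem kernelBlock_affine_posSemidef (hSneg : ∀ R ∈ S, -R ∈ S) (hγ : ∀ R, γ (-R) = (γ R)ᴴ)
    (c : (Fin d → ℤ) → ℝ)
    (hc : ∀ T ∈ defectSupport S, Real.sqrt (∑ i, ∑ j, ‖defectKernel S γ T i j‖ ^ 2) ≤ c T)
    {a b : ℝ} (ha : 0 ≤ a) (hab : a * (∑ T ∈ defectSupport S, c T) ≤ b)
    (hab1 : a * (1 + ∑ T ∈ defectSupport S, c T) + b ≤ 1) (κ : RectTorusSite k) :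
    ((a : ℂ) • kernelBlock S γ κ + (b : ℂ) • (1 : Matrix (RectTorusSite M) (RectTorusSite M) ℂ)).PosSemidef ∧
      (1 - ((a : ℂ) • kernelBlock S γ κ + (b : ℂ) • (1 : Matrix (RectTorusSite M) (RectTorusSite M) ℂ))).PosSemidef :=
  Literature.LinearAlgebra.Matrix.posSemidef_affine_shrink_of_sum (isHermitian_kernelBlock S γ hSneg hγ κ)
    (defectSupport S) (fun T => blockChar κ (cellVec k T) • defectKernel S γ T) c
    (kernelBlock_sub_sq S γ κ)
    (fun T hT => by rw [frobenius_blockChar_smul]; exact hc T hT) ha hab hab1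

/-- **The shrunk kernel** of a certificate: `γ = a γ̃ + b δ_{R,0} 1`. [cite: BachLiebSolovej1994, eq. (2c.4)] -/
def shrinkKernel (a b : ℝ) (R : Fin d → ℤ) : Matrix (RectTorusSite M) (RectTorusSite M) ℂ :=
  (a : ℂ) • γ R + if R = 0 then (b : ℂ) • 1 else 0

omit [∀ i, NeZero (M i)] in
/-- The blocks of the shrunk kernel are the affine images of the blocks: `Q_κ = a • Q̃_κ + b • 1`
(`0 ∈ S`). [cite: BachLiebSolovej1994, eq. (3a.2)] -/
theorem kernelBlock_shrinkKernel (h0 : (0 : Fin d → ℤ) ∈ S) (a b : ℝ) (κ : RectTorusSite k) :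
    kernelBlock S (shrinkKernel γ a b) κ =
      (a : ℂ) • kernelBlock S γ κ + (b : ℂ) • (1 : Matrix (RectTorusSite M) (RectTorusSite M) ℂ) := by
  unfold kernelBlock shrinkKernel
  simp_rw [smul_add, Finset.sum_add_distrib, smul_comm (blockChar κ _) (a : ℂ), ← Finset.smul_sum]
  congr 1
  rw [Finset.sum_eq_single_of_mem 0 h0 (fun R _ hR => by rw [if_neg hR, smul_zero]), if_pos rfl,
    cellVec_zero, blockChar_zero_right, one_smul]

omit [∀ i, NeZero (M i)] [∀ i, NeZero (k i)] in
/-- The shrunk kernel vanishes outside `S` when `γ̃` does (`0 ∈ S`). [cite: BachLiebSolovej1994, eq. (2c.4)] -/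
theorem shrinkKernel_eq_zero (h0 : (0 : Fin d → ℤ) ∈ S) (hγS : ∀ R ∉ S, γ R = 0) (a b : ℝ) :
    ∀ R ∉ S, shrinkKernel γ a b R = 0 := by
  intro R hR
  have hR0 : R ≠ 0 := fun h => hR (h ▸ h0)
  rw [shrinkKernel, hγS R hR, if_neg hR0, smul_zero, add_zero]

/-- **Admissibility of the shrunk kernel's blocks** (`0 ∈ S`): under the hypotheses of
`kernelBlock_affine_posSemidef`, `0 ⪯ kernelBlock S (shrinkKernel γ̃ a b) κ ⪯ 1`.
[cite: BachLiebSolovej1994, eq. (2c.4)] -/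
theorem kernelBlock_shrinkKernel_posSemidef (h0 : (0 : Fin d → ℤ) ∈ S) (hSneg : ∀ R ∈ S, -R ∈ S)
    (hγ : ∀ R, γ (-R) = (γ R)ᴴ) (c : (Fin d → ℤ) → ℝ)
    (hc : ∀ T ∈ defectSupport S, Real.sqrt (∑ i, ∑ j, ‖defectKernel S γ T i j‖ ^ 2) ≤ c T)
    {a b : ℝ} (ha : 0 ≤ a) (hab : a * (∑ T ∈ defectSupport S, c T) ≤ b)
    (hab1 : a * (1 + ∑ T ∈ defectSupport S, c T) + b ≤ 1) (κ : RectTorusSite k) :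
    (kernelBlock S (shrinkKernel γ a b) κ).PosSemidef ∧
      (1 - kernelBlock S (shrinkKernel γ a b) κ).PosSemidef := by
  rw [kernelBlock_shrinkKernel S γ h0]
  exact kernelBlock_affine_posSemidef S γ hSneg hγ c hc ha hab hab1 κ

end Kernel

/-! ### The certificate theorem: fixed cell counts, then the thermodynamic limit (`d = 2`) -/

section Certificate

variable {L : ℕ} [NeZero L] {k M : Fin 2 → ℕ} [∀ i, NeZero (k i)] [∀ i, NeZero (M i)]

omit [NeZero L] in
/-- `|cells| · |cell| = L²`. [folklore] -/
private theorem card_cells_mul_card_cell' (hkM : ∀ i, k i * M i = L) :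
    (Fintype.card (RectTorusSite k) : ℝ) * Fintype.card (RectTorusSite M) = (L : ℝ) ^ 2 := by
  rw [card_rectTorusSite_eq_prod, card_rectTorusSite_eq_prod, Fin.prod_univ_two, Fin.prod_univ_two]
  have h : ((k 0 * M 0 : ℕ) : ℝ) * ((k 1 * M 1 : ℕ) : ℝ) = (L : ℝ) ^ 2 := by rw [hkM 0, hkM 1]; ring
  push_cast at h ⊢
  rw [← h]
  ring

/-- **The quasi-free certificate bound at fixed cell counts.** For `U ≥ 0`, an `L × L` torus
(`L ≥ 3`) cut into cells of sides `M i ≥ 2` (`k i · M i = L`) with NO ALIASING of the kernel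
support `S` (symmetric, `0 ∈ S`), pre-shrink kernels `γ̃_σ` (zero outside `S`,
`γ̃_σ(-R) = γ̃_σ(R)ᴴ`) whose defect kernels obey `‖d_σ(T)‖_F ≤ c_σ(T)`, and shrink parameters
with `a_σ ≥ 0`, `a_σ Σ_T c_σ(T) ≤ b_σ`, `a_σ (1 + Σ_T c_σ(T)) + b_σ ≤ 1`: the shrunk kernel
`γ_σ = a_σ γ̃_σ + b_σ δ_{R,0} 1` satisfies
`e(t,U; re Σ_σ tr γ_σ(0) / |cell|) ≤ re qfCellEnergy t U γ / |cell| + 16|t|/L`.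
[cite: BachLiebSolovej1994, eq. (2c.36)][cite: Lieb1981, Theorem] -/
theorem energyDensity2D_le_qfCellEnergy_add (hkM : ∀ i, k i * M i = L) (hL : 3 ≤ L)
    (hM2 : ∀ i, 2 ≤ M i) (t : ℝ) {U : ℝ} (hU : 0 ≤ U) (S : Finset (Fin 2 → ℤ))
    (hS : NoAlias k S) (h0 : (0 : Fin 2 → ℤ) ∈ S) (hSneg : ∀ R ∈ S, -R ∈ S)
    (γt : Fin 2 → (Fin 2 → ℤ) → Matrix (RectTorusSite M) (RectTorusSite M) ℂ)
    (hγtS : ∀ σ, ∀ R ∉ S, γt σ R = 0) (hγt : ∀ σ R, γt σ (-R) = (γt σ R)ᴴ)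
    (c : Fin 2 → (Fin 2 → ℤ) → ℝ)
    (hc : ∀ σ, ∀ T ∈ defectSupport S, Real.sqrt (∑ i, ∑ j, ‖defectKernel S (γt σ) T i j‖ ^ 2) ≤ c σ T)
    (a b : Fin 2 → ℝ) (ha : ∀ σ, 0 ≤ a σ) (hab : ∀ σ, a σ * (∑ T ∈ defectSupport S, c σ T) ≤ b σ)
    (hab1 : ∀ σ, a σ * (1 + ∑ T ∈ defectSupport S, c σ T) + b σ ≤ 1)
    (hn0 : 0 < (∑ σ, (shrinkKernel (γt σ) (a σ) (b σ) 0).trace).re / Fintype.card (RectTorusSite M))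
    (hn2 : (∑ σ, (shrinkKernel (γt σ) (a σ) (b σ) 0).trace).re / Fintype.card (RectTorusSite M) < 2) :
    ThermodynamicLimit.energyDensity2D t U
        ((∑ σ, (shrinkKernel (γt σ) (a σ) (b σ) 0).trace).re / Fintype.card (RectTorusSite M)) ≤
      (qfCellEnergy t U (fun σ => shrinkKernel (γt σ) (a σ) (b σ))).re / Fintype.card (RectTorusSite M) +
        16 * |t| / L := by
  set γ : Fin 2 → (Fin 2 → ℤ) → Matrix (RectTorusSite M) (RectTorusSite M) ℂ :=
    fun σ => shrinkKernel (γt σ) (a σ) (b σ) with hγ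
  set Q : Fin 2 → RectTorusSite k → Matrix (RectTorusSite M) (RectTorusSite M) ℂ :=
    fun σ κ => kernelBlock S (γ σ) κ with hQ
  have hγS : ∀ σ, ∀ R ∉ S, γ σ R = 0 := fun σ => shrinkKernel_eq_zero S (γt σ) h0 (hγtS σ) (a σ) (b σ)
  have hQ01 : ∀ σ κ, (Q σ κ).PosSemidef ∧ (1 - Q σ κ).PosSemidef := fun σ κ =>
    kernelBlock_shrinkKernel_posSemidef S (γt σ) h0 hSneg (hγt σ) (c σ) (hc σ) (ha σ) (hab σ) (hab1 σ) κ
  -- the trace and the energy of the blocks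
  set cK : ℂ := (Fintype.card (RectTorusSite k) : ℂ) with hcK
  have htr : ∑ σ, ∑ κ, (Q σ κ).trace = cK * ∑ σ, (γ σ 0).trace := by
    rw [Finset.mul_sum]
    exact Finset.sum_congr rfl fun σ _ => sum_trace_kernelBlock S (γ σ) hS (hγS σ)
  have hE : blochEnergy t U Q = cK * qfCellEnergy t U γ := blochEnergy_kernelBlock S hS γ hγS t U
  have hcard := card_cells_mul_card_cell' hkM
  have hcM : (0 : ℝ) < Fintype.card (RectTorusSite M) := by exact_mod_cast Fintype.card_pos
  have hL2 : (0 : ℝ) < (L : ℝ) ^ 2 := by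
    have : (0 : ℝ) < L := by exact_mod_cast (show 0 < L by omega)
    positivity
  -- `re (cK z) / L² = re z / |cell|`
  have hscale : ∀ z : ℂ, (cK * z).re / (L : ℝ) ^ 2 = z.re / Fintype.card (RectTorusSite M) := by
    intro z
    rw [hcK, show (Fintype.card (RectTorusSite k) : ℂ) = ((Fintype.card (RectTorusSite k) : ℝ) : ℂ) by
      norm_cast, Complex.re_ofReal_mul, ← hcard]
    field_simp
  have hn_eq : (∑ σ, ∑ κ, (Q σ κ).trace).re / (L : ℝ) ^ 2 =
      (∑ σ, (γ σ 0).trace).re / Fintype.card (RectTorusSite M) := by rw [htr, hscale]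
  have hE_eq : (blochEnergy t U Q).re / (L : ℝ) ^ 2 =
      (qfCellEnergy t U γ).re / Fintype.card (RectTorusSite M) := by rw [hE, hscale]
  have hmain := energyDensity2D_le_bloch_of_posSemidef hkM hL hM2 t hU Q (fun σ κ => (hQ01 σ κ).1)
    (fun σ κ => (hQ01 σ κ).2) (by rw [hn_eq]; exact hn0) (by rw [hn_eq]; exact hn2)
  rw [hn_eq, hE_eq] at hmain
  exact hmain

omit [NeZero L] [∀ i, NeZero (k i)] in
/-- **No aliasing from a support radius**: if every `R ∈ S` has `|R i| ≤ Rc i` and `k i ≥ Rc i + 2`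
then `S` is not aliased by `k`. [folklore] -/
private theorem noAlias_of_radius {S : Finset (Fin 2 → ℤ)} {Rc k : Fin 2 → ℕ}
    (hRc : ∀ R ∈ S, ∀ i, |R i| ≤ Rc i) (hk : ∀ i, Rc i + 2 ≤ k i) : NoAlias k S := by
  intro R hR v hv hzero
  funext j
  have hj : ((R j - v j : ℤ) : ZMod (k j)) = 0 := by
    have := congrFun hzero j
    simpa [cellVec] using this
  rw [ZMod.intCast_zmod_eq_zero_iff_dvd] at hj
  have habs : |R j - v j| < (k j : ℤ) := by
    have h1 := hRc R hR j
    have h2 : |v j| ≤ 1 := by rcases hv j with h | h | h <;> simp [h]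
    have h3 := hk j
    calc |R j - v j| ≤ |R j| + |v j| := abs_sub _ _
      _ ≤ Rc j + 1 := by linarith
      _ < (k j : ℤ) := by exact_mod_cast (by omega : Rc j + 1 < k j)
  have := Int.eq_zero_of_abs_lt_dvd hj habs
  linarith

end Certificate

/-! ### The thermodynamic limit: the certificate's exact cell energy bounds the energy density -/

section Limit

variable {M : Fin 2 → ℕ} [∀ i, NeZero (M i)]

/-- **Soundness of a translation-invariant quasi-free certificate.** Cell sides `M i ≥ 2`; base cell
counts `k₀ i` with `k₀ i · M i = L₀` (a square torus) and `k₀ i ≥ Rc i + 2` (`Rc` = the support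
radius of `S`); kernel data as in `energyDensity2D_le_qfCellEnergy_add`. Then, along the tori of
`m k₀ i` cells (`L = m L₀ → ∞`), the `16|t|/L` boundary term disappears:
`e(t,U; re Σ_σ tr γ_σ(0)/|cell|) ≤ re qfCellEnergy t U γ / |cell|`.
This is the theorem a FORMAT-qf1 certificate instantiates: its reader-checked duties are exactly
the hypotheses (support radius, symmetry, Frobenius bounds of the integer defect kernel, the three
rational shrink inequalities, the density), and `qfCellEnergy` is its exact energy.
[cite: BachLiebSolovej1994, eq. (2c.36)][cite: Lieb1981, Theorem] -/
theorem energyDensity2D_le_qfCellEnergy (hM2 : ∀ i, 2 ≤ M i) (k₀ : Fin 2 → ℕ) (L₀ : ℕ)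
    (hk₀ : ∀ i, k₀ i * M i = L₀) (t : ℝ) {U : ℝ} (hU : 0 ≤ U) (S : Finset (Fin 2 → ℤ))
    (Rc : Fin 2 → ℕ) (hRc : ∀ R ∈ S, ∀ i, |R i| ≤ Rc i) (hkRc : ∀ i, Rc i + 2 ≤ k₀ i)
    (h0 : (0 : Fin 2 → ℤ) ∈ S) (hSneg : ∀ R ∈ S, -R ∈ S)
    (γt : Fin 2 → (Fin 2 → ℤ) → Matrix (RectTorusSite M) (RectTorusSite M) ℂ)
    (hγtS : ∀ σ, ∀ R ∉ S, γt σ R = 0) (hγt : ∀ σ R, γt σ (-R) = (γt σ R)ᴴ)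
    (c : Fin 2 → (Fin 2 → ℤ) → ℝ)
    (hc : ∀ σ, ∀ T ∈ defectSupport S, Real.sqrt (∑ i, ∑ j, ‖defectKernel S (γt σ) T i j‖ ^ 2) ≤ c σ T)
    (a b : Fin 2 → ℝ) (ha : ∀ σ, 0 ≤ a σ) (hab : ∀ σ, a σ * (∑ T ∈ defectSupport S, c σ T) ≤ b σ)
    (hab1 : ∀ σ, a σ * (1 + ∑ T ∈ defectSupport S, c σ T) + b σ ≤ 1)
    (hn0 : 0 < (∑ σ, (shrinkKernel (γt σ) (a σ) (b σ) 0).trace).re / Fintype.card (RectTorusSite M))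
    (hn2 : (∑ σ, (shrinkKernel (γt σ) (a σ) (b σ) 0).trace).re / Fintype.card (RectTorusSite M) < 2) :
    ThermodynamicLimit.energyDensity2D t U
        ((∑ σ, (shrinkKernel (γt σ) (a σ) (b σ) 0).trace).re / Fintype.card (RectTorusSite M)) ≤
      (qfCellEnergy t U (fun σ => shrinkKernel (γt σ) (a σ) (b σ))).re / Fintype.card (RectTorusSite M) := by
  set E : ℝ := (qfCellEnergy t U (fun σ => shrinkKernel (γt σ) (a σ) (b σ))).re /
    Fintype.card (RectTorusSite M) with hEdef
  have hk₀pos : ∀ i, 0 < k₀ i := fun i => by have := hkRc i; omega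
  have hL₀pos : 0 < L₀ := by
    have := hk₀ 0; have := hM2 0; have := hk₀pos 0; nlinarith
  -- the bound along `L = m L₀`, `m ≥ 3`
  have hm : ∀ m : ℕ, 3 ≤ m →
      ThermodynamicLimit.energyDensity2D t U
        ((∑ σ, (shrinkKernel (γt σ) (a σ) (b σ) 0).trace).re / Fintype.card (RectTorusSite M)) ≤
        E + 16 * |t| / ((m * L₀ : ℕ) : ℝ) := by
    intro m hm3
    let km : Fin 2 → ℕ := fun i => m * k₀ i
    haveI : ∀ i, NeZero (km i) := fun i => ⟨Nat.mul_ne_zero (by omega) (hk₀pos i).ne'⟩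
    haveI : NeZero (m * L₀) := ⟨Nat.mul_ne_zero (by omega) hL₀pos.ne'⟩
    have hkM : ∀ i, km i * M i = m * L₀ := fun i => by
      show m * k₀ i * M i = m * L₀; rw [mul_assoc, hk₀ i]
    have hL3 : 3 ≤ m * L₀ := le_trans hm3 (Nat.le_mul_of_pos_right m hL₀pos)
    have hS : NoAlias km S := noAlias_of_radius hRc fun i =>
      le_trans (hkRc i) (Nat.le_mul_of_pos_left (k₀ i) (by omega))
    exact energyDensity2D_le_qfCellEnergy_add (k := km) hkM hL3 hM2 t hU S hS h0 hSneg γt hγtS hγt c hc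
      a b ha hab hab1 hn0 hn2
  -- `m → ∞`
  have hlim : Filter.Tendsto (fun m : ℕ => E + 16 * |t| / ((m * L₀ : ℕ) : ℝ)) Filter.atTop (nhds (E + 0)) := by
    refine tendsto_const_nhds.add ?_
    have h1 : Filter.Tendsto (fun m : ℕ => ((m * L₀ : ℕ) : ℝ)) Filter.atTop Filter.atTop := by
      refine Filter.tendsto_atTop_mono (fun m => ?_) tendsto_natCast_atTop_atTop
      exact_mod_cast Nat.le_mul_of_pos_right m hL₀pos
    exact Filter.Tendsto.div_atTop tendsto_const_nhds h1
  rw [add_zero] at hlim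
  exact ge_of_tendsto hlim (Filter.eventually_atTop.2 ⟨3, fun m hm3 => hm m hm3⟩)

end Limit

end HartreeFock

end Literature.MathematicalPhysics.QuantumLattice
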